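import Summits.QuantumFields.YangMills.Theses.BalabanUVNodes

/-!
# CRIT-1 g5 PROBES for the finding check of `REV26-PRESS-AUDIT-idea4-g11.md` (ed.2 703eebc41a764d66) ∕ kernel
`Idea4g11RegimeFilterSketch.lean` (a7b3452259efc4d5) — K2⁷ `EndpointGivenBR13SepCoPH` (stmt-QuantumFields-20543)

Seat ym-nodeO-crit-1 gen 5 (refuter-ym-nodeO-crit-1-g5-0), 2026-08-28. NOT part of the kernel of record; a SEPARATE namespace
(`…Idea4g11Crit1`) so that no FQN of the kernel is re-declared. §0 re-copies VERBATIM from the kernel the nine declarations the probes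
need (`Inhabited13`, `K1L`, `K2L`, `byEps29Uniform`, `setEps29`, `byEps29Frozen`, `k1L_byEps29Frozen_iff`, `bySeam2`, `setEps29Gamma`);
§1 are the probes:

* (P1a–c) the displayed regimes `byEps29Frozen`, `byEps29Uniform`, `bySeam2 set2` are PROPER filters given ONE tuple (the BC7 vacuity
  guard of `K2L 𝓛`, the memo's (F2)) — kernel-certified here;
* (P2, P2′) Variant T UNFOLDED: `K2L byEps29Uniform ↔ ∀ F, ∃ ε > 0, ∀ θ, 0 < θ.ε₂₉ → θ.ε₂₉ < ε → ⟨K2⁷'s body⟩` — the memo DEFINES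
  `byEps29Uniform` but proves no `iff` against drawer D82-REV26's `K2T` words; this closes that gap (`<` for `≤`, sign clause explicit);
* (P3, P3′) along a frozen-class regime (`⨆ θ₀, map (setter θ₀) G` — the shape the memo gives `printRegime13`) K1 is discharged by
  EVENTUALLY ALONG ONE CLASS (`∃ θ₀, ∀ᶠ ℓ in G, …`), whereas `k1L_of_eventually`'s hypothesis at such a regime quantifies over EVERY class
  (P3′) — so the memo's §0 line 4 parenthesis names the wrong entry lemma for its own regime shape (harmless: `k1L_byEps29Frozen_iff` has
  the right `∃ θ₀, ∃ᶠ` form);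
* (P4) T dominates the two-letter seam model too (`bySeam2 setEps29Gamma ≤ byEps29Uniform`): among the five displays `⊤` is the top,
  T lies above S′ (kernel `byEps29Frozen_le_uniform`) AND above the seam-2 model, and `𝓟 {rows}` is a side branch incomparable with them —
  «the K1-maximal end» (memo §0 line 2) is not an order-theoretic statement about one chain.

HONEST FRAMING: filter bookkeeping only; NOTHING of Bałaban's analysis is asserted or discharged; K2⁷ OPEN; [Balaban1987RG1] Thm 2 +
(0.31) p.259 unproved in print; route R4 closes ONLY the CONDITIONAL finite-𝕋⁴ rung `BalabanLadder.UV` — not continuum, not OS, not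
the Yang–Mills mass gap, not Clay.
-/

namespace Summit.QuantumFields.YangMills.Cruxes.EndpointGivenBR13SepCoPH.Idea4g11Crit1

open Filter Topology Set
open scoped Filter Topology
open Literature.MathematicalPhysics.QuantumFieldTheory.Balaban1983to89
open Literature.MathematicalPhysics.QuantumFieldTheory.Balaban1983to89.FlowStep
open Literature.MathematicalPhysics.QuantumFieldTheory.Balaban1983to89.DagBinding (EndpointExistence)
open Literature.MathematicalPhysics.QuantumFieldTheory.Balaban1983to89.T4Continuum (T4Family)
open Summit.QuantumFields.YangMills.Theses.BalabanUVNodes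

/-! ## §0 Verbatim copies from the kernel (a7b3452259efc4d5; docstrings included) -/


/-- K0⁷'s body at the family `F` (= the antecedent of K1⁷, verbatim). [cite: Balaban1987RG1, (0.19)–(0.21) p.256 (bookkeeping)] -/
abbrev Inhabited13 (F : T4Family) : Prop :=
  ∃ θ : Node00.Stage13HParams F 2, θ.Provisos₁₃SepCoPH F 2 ∧ (θ.ZhUnity F 2 ∧ θ.SlotsNondegenerate₁₃ F 2) ∧ θ.Admissible F 2

section Seam

variable (𝓛 : (F : T4Family) → Filter (Node00.Stage13HParams F 2))

/-- **K1ᴸ** — K1's family ENTERS every `𝓛`-large set of tuples: frequently along `𝓛 F`, some proviso'd tuple carries unity ∧ slots ∧ admissible ∧ (B) ∧ window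
(K1⁷'s consequent verbatim under `∃ᶠ`). [cite: Balaban1989LargeFieldII, Thm 1 + (0.1) pp.355–356; Balaban1988Convergent, (2.10) p.256] -/
def K1L : Prop :=
  ∀ F : T4Family, Inhabited13 F → ∃ᶠ θ in 𝓛 F, ∃ hP : θ.Provisos₁₃SepCoPH F 2,
    (θ.ZhUnity F 2 ∧ θ.SlotsNondegenerate₁₃ F 2) ∧ θ.Admissible F 2 ∧
    B16.EndStatementBPrinted (Node00.datumOfRecord₁₃SepCoPH F 2 θ hP).C ∧
    ∃ γ₁ : ℝ, 0 < γ₁ ∧ ∀ γ : ℝ, 0 < γ → γ ≤ γ₁ →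
      ∃ P : B12.RunParams, 1 ≤ P.K ∧ ((Node00.datumOfRecord₁₃SepCoPH F 2 θ hP).C P).flow.InInterval γ P.K


/-- **K2ᴸ** — node O owes END only `𝓛`-EVENTUALLY: for all tuples far enough along the regime, K2⁷'s body verbatim.
[cite: Balaban1987RG1, Thm 2 p.259 (first sentence), Thm 3 p.264] -/
def K2L : Prop :=
  ∀ F : T4Family, ∀ᶠ θ in 𝓛 F, ∀ hP : θ.Provisos₁₃SepCoPH F 2,
    (θ.ZhUnity F 2 ∧ θ.SlotsNondegenerate₁₃ F 2) → θ.Admissible F 2 →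
    B16.EndStatementBPrinted (Node00.datumOfRecord₁₃SepCoPH F 2 θ hP).C →
    (∃ γ₁ : ℝ, 0 < γ₁ ∧ ∀ γ : ℝ, 0 < γ → γ ≤ γ₁ →
      ∃ P : B12.RunParams, 1 ≤ P.K ∧ ((Node00.datumOfRecord₁₃SepCoPH F 2 θ hP).C P).flow.InInterval γ P.K) →
    EndpointExistence (Node00.datumOfRecord₁₃SepCoPH F 2 θ hP).C.toB12


end Seam

/-- **Variant T's regime** (drawer D82-REV26 `K2T := ∀ F, ∃ ε > 0, ∀ θ …, θ.ε₂₉ ≤ ε → …`): the (2.9) threshold tends to `0⁺` UNIFORMLY in every other letter.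
[cite: Balaban1987RG1, (2.9) p.266, Thm 3 p.264] -/
def byEps29Uniform (F : T4Family) : Filter (Node00.Stage13HParams F 2) :=
  Filter.comap (fun θ : Node00.Stage13HParams F 2 => θ.ε₂₉) (𝓝[>] (0 : ℝ))


/-- The ε₂₉-ray through a tuple: `θ₀` with its (2.9) threshold replaced (every other letter frozen). [cite: Balaban1987RG1, (2.9) p.266 (bookkeeping)] -/
def setEps29 {F : T4Family} (θ₀ : Node00.Stage13HParams F 2) (e : ℝ) : Node00.Stage13HParams F 2 :=
  { θ₀ with ε₂₉ := e }

/-- The replaced threshold is the one read back. [folklore] -/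
theorem eps29_setEps29 {F : T4Family} (θ₀ : Node00.Stage13HParams F 2) (e : ℝ) : (setEps29 θ₀ e).ε₂₉ = e := rfl

/-- **The seam game S′'s regime**: ε₂₉ → 0⁺ along every frozen class (the threshold node O needs MAY depend on the other letters of the class).
[cite: Balaban1987RG1, (2.9) p.266, Thm 3 p.264] -/
def byEps29Frozen (F : T4Family) : Filter (Node00.Stage13HParams F 2) :=
  ⨆ θ₀ : Node00.Stage13HParams F 2, Filter.map (setEps29 θ₀) (𝓝[>] (0 : ℝ))


/-- S′'s K1 item UNFOLDED: some frozen class along which K1's conjuncts hold for ε₂₉ FREQUENTLY near `0⁺` (a family parametric in ε₂₉ gives eventually, hence this).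
[cite: Balaban1989LargeFieldII, Thm 1 pp.355–356 (bookkeeping)] -/
theorem k1L_byEps29Frozen_iff : K1L byEps29Frozen ↔
    ∀ F : T4Family, Inhabited13 F → ∃ θ₀ : Node00.Stage13HParams F 2, ∃ᶠ e in 𝓝[>] (0 : ℝ),
      ∃ hP : (setEps29 θ₀ e).Provisos₁₃SepCoPH F 2,
      ((setEps29 θ₀ e).ZhUnity F 2 ∧ (setEps29 θ₀ e).SlotsNondegenerate₁₃ F 2) ∧ (setEps29 θ₀ e).Admissible F 2 ∧
      B16.EndStatementBPrinted (Node00.datumOfRecord₁₃SepCoPH F 2 (setEps29 θ₀ e) hP).C ∧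
      ∃ γ₁ : ℝ, 0 < γ₁ ∧ ∀ γ : ℝ, 0 < γ → γ ≤ γ₁ →
        ∃ P : B12.RunParams, 1 ≤ P.K ∧ ((Node00.datumOfRecord₁₃SepCoPH F 2 (setEps29 θ₀ e) hP).C P).flow.InInterval γ P.K := by
  simp only [K1L, byEps29Frozen, frequently_iSup, frequently_map]

section Seam2

variable (set2 : (F : T4Family) → Node00.Stage13HParams F 2 → ℝ × ℝ → Node00.Stage13HParams F 2)


/-- **Print's ORDER OF CONSTANTS as a regime (two-letter model)**: through any letters-setter `set2 F θ₀ (e, g)` («first letter `e`, then `g`»), the iterated filter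
`(𝓝[>] 0).curry (𝓝[>] 0)` — «`e` sufficiently small, then `g` sufficiently small GIVEN `e`» — along every frozen class.  More letters = a longer curry chain
(`atTop` for `κ`, `M`; `𝓝[>] 0` for `ε₀`, `ε₁ = ε₂₉`, `α₀`, `α₁`, `γ`), in print's order. [cite: Balaban1987RG1, Thm 3 p.264; Balaban1985Variational, Thm 1 (order of the constants)] -/
def bySeam2 (F : T4Family) : Filter (Node00.Stage13HParams F 2) :=
  ⨆ θ₀ : Node00.Stage13HParams F 2, Filter.map (set2 F θ₀) ((𝓝[>] (0 : ℝ)).curry (𝓝[>] (0 : ℝ)))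

end Seam2

/-- A concrete two-letter setter on the record: `(ε₂₉, γ) := (e, g)`, everything else frozen («ε₁ first, then γ ≤ γ̄(ε₁)», [I] Thm 3 p.264).
[cite: Balaban1987RG1, (2.9) p.266, Thm 3 p.264 (bookkeeping)] -/
def setEps29Gamma (F : T4Family) (θ₀ : Node00.Stage13HParams F 2) (p : ℝ × ℝ) : Node00.Stage13HParams F 2 :=
  { θ₀ with ε₂₉ := p.1, γ := p.2 }


/-! ## §1 The probes -/

/-- (P1a) the frozen-class regime is proper given one tuple. [folklore] -/
theorem crit1_byEps29Frozen_neBot (F : T4Family) (θ₀ : Node00.Stage13HParams F 2) : (byEps29Frozen F).NeBot :=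
  (Filter.map_neBot : (Filter.map (setEps29 θ₀) (𝓝[>] (0 : ℝ))).NeBot).mono
    (le_iSup (fun θ : Node00.Stage13HParams F 2 => Filter.map (setEps29 θ) (𝓝[>] (0 : ℝ))) θ₀)

/-- (P1b) Variant T's regime is proper given one tuple. [folklore] -/
theorem crit1_byEps29Uniform_neBot (F : T4Family) (θ₀ : Node00.Stage13HParams F 2) : (byEps29Uniform F).NeBot :=
  Filter.comap_neBot fun _t ht => let ⟨e, he⟩ := Filter.nonempty_of_mem ht; ⟨setEps29 θ₀ e, he⟩

/-- (P1c) the two-letter seam regime is proper given one tuple (the curried filter of two proper filters is proper). [folklore] -/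
theorem crit1_bySeam2_neBot (set2 : (F : T4Family) → Node00.Stage13HParams F 2 → ℝ × ℝ → Node00.Stage13HParams F 2)
    (F : T4Family) (θ₀ : Node00.Stage13HParams F 2) : (bySeam2 set2 F).NeBot := by
  haveI : ((𝓝[>] (0 : ℝ)).curry (𝓝[>] (0 : ℝ))).NeBot := ⟨fun h => by
    have h' : ∀ᶠ _a in 𝓝[>] (0 : ℝ), ∀ᶠ _b in 𝓝[>] (0 : ℝ), False :=
      (Filter.eventually_curry_iff (p := fun _ => False)).1 (Filter.eventually_false_iff_eq_bot.2 h)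
    exact absurd (Filter.eventually_false_iff_eq_bot.1
      (h'.mono fun a ha => absurd (Filter.eventually_false_iff_eq_bot.1 ha) (nhdsGT_neBot (0 : ℝ)).ne))
      (nhdsGT_neBot (0 : ℝ)).ne⟩
  exact (Filter.map_neBot : (Filter.map (set2 F θ₀) ((𝓝[>] (0 : ℝ)).curry (𝓝[>] (0 : ℝ)))).NeBot).mono
    (le_iSup (fun θ : Node00.Stage13HParams F 2 => Filter.map (set2 F θ) ((𝓝[>] (0 : ℝ)).curry (𝓝[>] (0 : ℝ)))) θ₀)

/-- (P2) Variant T unfolded: «∃ ε > 0, for ALL tuples with `0 < ε₂₉ < ε`» — drawer D82-REV26's `K2T` shape up to `<`∕`≤` and the sign clause. [folklore] -/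
theorem crit1_eventually_byEps29Uniform_iff {F : T4Family} {P : Node00.Stage13HParams F 2 → Prop} :
    (∀ᶠ θ in byEps29Uniform F, P θ) ↔ ∃ ε : ℝ, 0 < ε ∧ ∀ θ : Node00.Stage13HParams F 2, 0 < θ.ε₂₉ → θ.ε₂₉ < ε → P θ := by
  rw [byEps29Uniform, Filter.eventually_comap]
  constructor
  · intro h
    obtain ⟨ε, hε, hsub⟩ := mem_nhdsGT_iff_exists_Ioo_subset.1 h
    exact ⟨ε, hε, fun θ h0 hlt => hsub (show θ.ε₂₉ ∈ Ioo 0 ε from ⟨h0, hlt⟩) θ rfl⟩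
  · rintro ⟨ε, hε, h⟩
    exact mem_nhdsGT_iff_exists_Ioo_subset.2 ⟨ε, hε, fun e he θ hθ => h θ (hθ ▸ he.1) (hθ ▸ he.2)⟩

/-- (P2′) hence `K2L byEps29Uniform` in the drawer's words. [folklore] -/
theorem crit1_k2L_byEps29Uniform_iff : K2L byEps29Uniform ↔
    ∀ F : T4Family, ∃ ε : ℝ, 0 < ε ∧ ∀ θ : Node00.Stage13HParams F 2, 0 < θ.ε₂₉ → θ.ε₂₉ < ε →
      ∀ hP : θ.Provisos₁₃SepCoPH F 2,
      (θ.ZhUnity F 2 ∧ θ.SlotsNondegenerate₁₃ F 2) → θ.Admissible F 2 →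
      B16.EndStatementBPrinted (Node00.datumOfRecord₁₃SepCoPH F 2 θ hP).C →
      (∃ γ₁ : ℝ, 0 < γ₁ ∧ ∀ γ : ℝ, 0 < γ → γ ≤ γ₁ →
        ∃ P : B12.RunParams, 1 ≤ P.K ∧ ((Node00.datumOfRecord₁₃SepCoPH F 2 θ hP).C P).flow.InInterval γ P.K) →
      EndpointExistence (Node00.datumOfRecord₁₃SepCoPH F 2 θ hP).C.toB12 :=
  forall_congr' fun _ => crit1_eventually_byEps29Uniform_iff

/-- (P3) K1 along the frozen-class regime from EVENTUALLY along ONE class (the right entry for `⨆ θ₀, map …` regimes). [folklore] -/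
theorem crit1_k1L_frozen_of_one_class
    (h : ∀ F : T4Family, Inhabited13 F → ∃ θ₀ : Node00.Stage13HParams F 2, ∀ᶠ e in 𝓝[>] (0 : ℝ),
      ∃ hP : (setEps29 θ₀ e).Provisos₁₃SepCoPH F 2,
      ((setEps29 θ₀ e).ZhUnity F 2 ∧ (setEps29 θ₀ e).SlotsNondegenerate₁₃ F 2) ∧ (setEps29 θ₀ e).Admissible F 2 ∧
      B16.EndStatementBPrinted (Node00.datumOfRecord₁₃SepCoPH F 2 (setEps29 θ₀ e) hP).C ∧
      ∃ γ₁ : ℝ, 0 < γ₁ ∧ ∀ γ : ℝ, 0 < γ → γ ≤ γ₁ →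
        ∃ P : B12.RunParams, 1 ≤ P.K ∧ ((Node00.datumOfRecord₁₃SepCoPH F 2 (setEps29 θ₀ e) hP).C P).flow.InInterval γ P.K) :
    K1L byEps29Frozen := by
  rw [k1L_byEps29Frozen_iff]
  intro F hF
  obtain ⟨θ₀, h⟩ := h F hF
  exact ⟨θ₀, h.frequently⟩

/-- (P3′) … whereas EVENTUALLY along the frozen-class regime (the hypothesis shape of the kernel's `k1L_of_eventually` at this regime) quantifies over
EVERY class `θ₀` — junk classes included. [folklore] -/
theorem crit1_eventually_byEps29Frozen_iff {F : T4Family} {P : Node00.Stage13HParams F 2 → Prop} :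
    (∀ᶠ θ in byEps29Frozen F, P θ) ↔ ∀ θ₀ : Node00.Stage13HParams F 2, ∀ᶠ e in 𝓝[>] (0 : ℝ), P (setEps29 θ₀ e) := by
  simp only [byEps29Frozen, eventually_iSup, eventually_map]

/-- (P4) Variant T dominates the two-letter seam model as well (so `K2L byEps29Uniform → K2L (bySeam2 setEps29Gamma)`). [folklore] -/
theorem crit1_bySeam2Gamma_le_uniform (F : T4Family) : bySeam2 setEps29Gamma F ≤ byEps29Uniform F := by
  refine iSup_le fun θ₀ => ?_
  rw [byEps29Uniform, Filter.map_le_iff_le_comap, Filter.comap_comap]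
  have hid : ((fun θ : Node00.Stage13HParams F 2 => θ.ε₂₉) ∘ setEps29Gamma F θ₀) = Prod.fst := funext fun _ => rfl
  rw [hid, ← Filter.map_le_iff_le_comap]
  exact (Filter.map_mono Filter.curry_le_prod).trans Filter.tendsto_fst

end Summit.QuantumFields.YangMills.Cruxes.EndpointGivenBR13SepCoPH.Idea4g11Crit1
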